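import Summits.NavierStokesRegularity.NavierStokesRegularity.Theses.TypeILiouville
import Literature.Analysis.FluidPDE.NSStrongSpeedBound
import Literature.Analysis.FluidPDE.TaoLocalisationHolds
import Literature.Analysis.FluidPDE.TaoLocalisationProofs
import Literature.Analysis.FluidPDE.NSFiniteEnergySmoothProofs
import HarnessLib

/-!
# No hyper-fast blow-up: a sup-speed time budget `∫‖u‖_∞^q < ∞` excludes persistent rates
# `‖u(t)‖_∞ ≥ c (T - t)^{-β}` with `β q ≥ 1`; unconditionally for `q = 1`, `β ≥ 1`
# (crux `TypeIliouvilleNoTypeII`, stmt-NavierStokesRegularity-0056; §B CANDIDATE 2 `SupSpeedBudget`)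

Helper file (theorems only) for the Type-II side of the hard core `NoTypeII`.  The §B candidate
«SupSpeedBudget(q)» (lens `transfer`, HOME/ns-plan-lens-transfer-typeII/SupSpeedBudget.lean) is the
a-priori inequality `∫₀ᵀ ‖u(t)‖_∞^q dt ≤ K_q(ν, E, T)` for strong classical solutions on closed
slabs; at `q = 1` it is the PROVED bounded-total-speed theorem of the tree
(`Literature.Analysis.FluidPDE.tao2011_boundedTotalSpeed_of_hasBoundedSobolevNormsOn`, Foias–Guillopé–Temam 1981 /
Tao 2013 Prop. 9.1).  Its two support stubs are typed there as `Prop`s to be proved: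
`BudgetKillsHyperfast q β` (real analysis: a budget with exponent `q`, uniform on the closed
sub-slabs `[0, T']`, `T' ↑ T`, excludes a PERSISTENT sup-norm rate `≥ c (T - t)^{-β}` when
`β q ≥ 1`) and `FrameIsStrong` (frame solutions are strong on closed sub-slabs).  This file proves
both contents in UNFOLDED form (no new definitions) and draws the unconditional consequence:

* `lintegral_ofReal_mul_rpow_neg_eq_top` — `∫_{(t₁,T)} c (T - t)^{-s} dt = ∞` for `s ≥ 1`, `c > 0`
  (reflection `t ↦ T - t` + `intervalIntegral.integrableOn_Ioo_rpow_iff`);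
* `not_persistentRate_of_uniform_budget` — THE GLUE: if `∫_{(0,T')} g^q ≤ B < ∞` for every
  `T' < T`, `1 ≤ q`, `1 ≤ β q`, `c > 0`, then NOT `∀ᶠ t ↑ T, ofReal (c (T - t)^{-β}) ≤ g t`;
* `exists_uniform_speedBudget` — for a classical solution on `[0, T)`, Leray–Hopf from a rapidly
  decaying datum: `∫_{(0,T')} ‖u(t)‖_∞ dt ≤ B` with ONE finite `B` for all `T' < T` (strong class on
  closed sub-slabs by `tao2011_hasBoundedSobolevNormsOn_holds`, dissipation `≤ C ∫|u₀|²` uniformly by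
  `tao_finite_energy_smooth_energy_bound_holds`, and the total-speed bound, monotone in `T'`);
* `not_persistentRate_of_lerayHopf` — **unconditionally, no frame solution (in particular no
  maximal one, i.e. no first blow-up) has a persistent sup-norm rate `‖u(t)‖_∞ ≥ c (T - t)^{-β}`
  with `β ≥ 1`** (`NoHyperfastBlowup β` of the candidate file, `β ≥ 1`, with its strong-class
  hypothesis discharged) — an UPPER bound, in the persistent sense, on Type-II blow-up rates.

WHAT THIS IS NOT: not NS regularity and not `NoTypeII` (which is the persistent-rate exclusion for
every `β > 1/2` in the `limsup` sense); the window `1/2 < β < 1` is exactly the candidate's open range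
`1 < q < 4/3` (up to `β = 3/4`) plus the gap `[3/4, 1)`.
-/

noncomputable section

-- the summit and its single problem share the name `NavierStokesRegularity` (D-0017 nested layout)
set_option linter.dupNamespace false

open Set Function Filter Topology MeasureTheory Metric
open scoped NNReal ENNReal

namespace Summit.NavierStokesRegularity.NavierStokesRegularity.Theorems.TypeIliouvilleNoTypeII.SpeedBudget

open Literature.Analysis Literature.Analysis.FluidPDE

/-! ## Divergence of `∫ (T - t)^{-s}` at `T` for `s ≥ 1` -/

/-- `∫_{(t₁, T)} c (T - t)^{-s} dt = ∞` (as a lower Lebesgue integral of `ofReal`) for `t₁ < T`,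
`s ≥ 1`, `c > 0`: otherwise `x ↦ x^{-s}` would be integrable on `(0, T - t₁)`, contradicting
`intervalIntegral.integrableOn_Ioo_rpow_iff`. [folklore] -/
theorem lintegral_ofReal_mul_rpow_neg_eq_top {t₁ T s c : ℝ} (ht : t₁ < T) (hs : 1 ≤ s)
    (hc : 0 < c) :
    ∫⁻ t in Ioo t₁ T, ENNReal.ofReal (c * (T - t) ^ (-s)) = ⊤ := by
  by_contra hne
  have hcont : ContinuousOn (fun t : ℝ => c * (T - t) ^ (-s)) (Ioo t₁ T) := by
    refine continuousOn_const.mul (ContinuousOn.rpow_const ?_ fun t ht => Or.inl ?_)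
    · exact (continuous_const.sub continuous_id).continuousOn
    · exact sub_ne_zero.2 (ne_of_gt ht.2)
  have hnn : 0 ≤ᵐ[volume.restrict (Ioo t₁ T)] fun t : ℝ => c * (T - t) ^ (-s) :=
    ae_restrict_of_forall_mem measurableSet_Ioo fun t ht =>
      mul_nonneg hc.le (Real.rpow_nonneg (by linarith [ht.2]) _)
  have hint : IntegrableOn (fun t : ℝ => c * (T - t) ^ (-s)) (Ioo t₁ T) :=
    ⟨hcont.aestronglyMeasurable measurableSet_Ioo,
      (hasFiniteIntegral_iff_ofReal hnn).2 (lt_top_iff_ne_top.2 hne)⟩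
  have hint' : IntegrableOn (fun t : ℝ => (T - t) ^ (-s)) (Ioo t₁ T) := by
    have h : IntegrableOn (fun t : ℝ => c⁻¹ * (c * (T - t) ^ (-s))) (Ioo t₁ T) :=
      hint.const_mul c⁻¹
    refine h.congr_fun (fun t _ => ?_) measurableSet_Ioo
    show c⁻¹ * (c * (T - t) ^ (-s)) = (T - t) ^ (-s)
    rw [← mul_assoc, inv_mul_cancel₀ hc.ne', one_mul]
  have hII : IntervalIntegrable (fun t : ℝ => (T - t) ^ (-s)) volume t₁ T :=
    (intervalIntegrable_iff_integrableOn_Ioo_of_le ht.le).2 hint'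
  have hII' := hII.comp_sub_left T
  have e : (fun x : ℝ => (T - (T - x)) ^ (-s)) = fun x => x ^ (-s) := funext fun x => by
    rw [sub_sub_cancel]
  rw [e, sub_self] at hII'
  have hIO : IntegrableOn (fun x : ℝ => x ^ (-s)) (Ioo 0 (T - t₁)) :=
    (intervalIntegrable_iff_integrableOn_Ioo_of_le (by linarith)).1 hII'.symm
  have := (intervalIntegral.integrableOn_Ioo_rpow_iff (by linarith : 0 < T - t₁)).1 hIO
  linarith

/-! ## The glue: a uniform `L^q_t` budget kills persistent rates `β` with `β q ≥ 1` -/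

/-- An eventual statement at `T⁻` holds on a final interval `(t₁, T)` with `0 ≤ t₁ < T`
(for `0 < T`). [folklore] -/
theorem exists_Ioo_of_eventually_nhdsLT {T : ℝ} (hT : 0 < T) {P : ℝ → Prop}
    (h : ∀ᶠ t in 𝓝[<] T, P t) : ∃ t₁, 0 ≤ t₁ ∧ t₁ < T ∧ ∀ t ∈ Ioo t₁ T, P t := by
  obtain ⟨l, hl, hsub⟩ := mem_nhdsLT_iff_exists_Ioo_subset.1 h
  exact ⟨max l 0, le_max_right _ _, max_lt hl hT,
    fun t ht => hsub ⟨(le_max_left _ _).trans_lt ht.1, ht.2⟩⟩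

/-- **A uniform `L^q_t` budget excludes persistent rates `β` with `β q ≥ 1`** (the content of the
candidate's support stub `BudgetKillsHyperfast`, unfolded).  If `g : ℝ → [0, ∞]` satisfies
`∫_{(0,T')} g^q ≤ B` for EVERY `T' < T` with one `B < ∞`, `1 ≤ q`, `1 ≤ β q` and `c > 0`, then it
is NOT the case that `ofReal (c (T - t)^{-β}) ≤ g t` for all `t` near `T⁻`: on such a final interval
`g^q ≥ c^q (T - t)^{-β q}`, whose integral up to `T` diverges (`lintegral_ofReal_mul_rpow_neg_eq_top`),
while the budgets on `(t₁, T - δ_n)` are all `≤ B` and exhaust `(t₁, T)`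
(`setLIntegral_iUnion_of_directed`). [folklore] -/
theorem not_persistentRate_of_uniform_budget {g : ℝ → ℝ≥0∞} {T q β c : ℝ} {B : ℝ≥0∞}
    (hT : 0 < T) (hq : 1 ≤ q) (hβq : 1 ≤ β * q) (hc : 0 < c) (hBtop : B ≠ ⊤)
    (hB : ∀ T' < T, ∫⁻ t in Ioo 0 T', g t ^ q ≤ B) :
    ¬ ∀ᶠ t in 𝓝[<] T, ENNReal.ofReal (c * (T - t) ^ (-β)) ≤ g t := by
  intro hP
  obtain ⟨t₁, ht₁0, ht₁T, hrate⟩ := exists_Ioo_of_eventually_nhdsLT hT hP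
  have hq0 : 0 ≤ q := zero_le_one.trans hq
  -- the divergent integral
  set F : ℝ → ℝ≥0∞ := fun t => ENNReal.ofReal (c ^ q * (T - t) ^ (-(β * q))) with hF
  have htop : ∫⁻ t in Ioo t₁ T, F t = ⊤ :=
    lintegral_ofReal_mul_rpow_neg_eq_top ht₁T hβq (Real.rpow_pos_of_pos hc q)
  -- pointwise on `(t₁, T)`: `F ≤ g^q`
  have hFle : ∀ t ∈ Ioo t₁ T, F t ≤ g t ^ q := by
    intro t ht
    have hTt : 0 ≤ T - t := by linarith [ht.2]
    have hy : 0 ≤ (T - t) ^ (-β) := Real.rpow_nonneg hTt _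
    have h1 : ENNReal.ofReal (c * (T - t) ^ (-β)) ^ q ≤ g t ^ q :=
      ENNReal.rpow_le_rpow (hrate t ht) hq0
    have h2 : ENNReal.ofReal (c * (T - t) ^ (-β)) ^ q = F t := by
      rw [hF, ENNReal.ofReal_rpow_of_nonneg (mul_nonneg hc.le hy) hq0, Real.mul_rpow hc.le hy,
        ← Real.rpow_mul hTt]
      congr 2
      ring_nf
    rw [← h2]
    exact h1
  -- exhaust `(t₁, T)` by the intervals `(t₁, T - δ_n)`, `δ_n = (T - t₁)/(n+2)`
  set s : ℕ → Set ℝ := fun n => Ioo t₁ (T - (T - t₁) / ((n : ℝ) + 2)) with hs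
  have hδpos : ∀ n : ℕ, 0 < (T - t₁) / ((n : ℝ) + 2) := fun n => by
    have : (0 : ℝ) < n + 2 := by positivity
    exact div_pos (by linarith) this
  have hmono : Monotone s := by
    intro m n hmn
    refine Ioo_subset_Ioo le_rfl ?_
    have hm : (0 : ℝ) < m + 2 := by positivity
    have hmn' : (m : ℝ) + 2 ≤ n + 2 := by exact_mod_cast Nat.add_le_add_right hmn 2
    have := div_le_div_of_nonneg_left (by linarith : 0 ≤ T - t₁) hm hmn'
    linarith
  have hUnion : (⋃ n, s n) = Ioo t₁ T := by
    apply Subset.antisymm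
    · exact iUnion_subset fun n => Ioo_subset_Ioo le_rfl (by linarith [hδpos n])
    · intro t ht
      obtain ⟨n, hn⟩ := exists_nat_gt ((T - t₁) / (T - t))
      have hTt : 0 < T - t := by linarith [ht.2]
      refine mem_iUnion.2 ⟨n, ht.1, ?_⟩
      have hn2 : (T - t₁) / (T - t) < (n : ℝ) + 2 := by linarith
      have : (T - t₁) / ((n : ℝ) + 2) < T - t := by
        rw [div_lt_iff₀ (by positivity)]
        rw [div_lt_iff₀ hTt] at hn2
        linarith
      linarith
  have hle : ∫⁻ t in Ioo t₁ T, F t ≤ B := by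
    rw [← hUnion, setLIntegral_iUnion_of_directed F hmono.directed_le]
    refine iSup_le fun n => ?_
    have hTn : T - (T - t₁) / ((n : ℝ) + 2) < T := by linarith [hδpos n]
    calc ∫⁻ t in s n, F t ≤ ∫⁻ t in s n, g t ^ q :=
          setLIntegral_mono' measurableSet_Ioo fun t ht =>
            hFle t (Ioo_subset_Ioo le_rfl hTn.le ht)
      _ ≤ ∫⁻ t in Ioo 0 (T - (T - t₁) / ((n : ℝ) + 2)), g t ^ q :=
          lintegral_mono_set (Ioo_subset_Ioo ht₁0 le_rfl)
      _ ≤ B := hB _ hTn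
  exact hBtop (top_le_iff.1 (htop ▸ hle))

/-! ## The uniform `q = 1` budget of a frame solution (bounded total speed on closed sub-slabs) -/

/-- **Uniform total-speed budget** (the content of the candidate's `FrameIsStrong` + the dissipation
bound, for `q = 1`).  A classical solution of Navier–Stokes on `ℝ³ × [0, T)`, Leray–Hopf from a
rapidly decaying datum, has `∫_{(0,T')} ‖u(t)‖_{L^∞} dt ≤ B` for every `T' < T` with ONE finite
`B` (depending on `ν`, `T` and the datum): on each closed sub-slab `[0, T']` the solution is in the
strong class (`tao2011_hasBoundedSobolevNormsOn_holds`, energy bounded by the Leray–Hopf energy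
inequality), its dissipation is `≤ C ∫|u₀|²` with Tao's universal `C`
(`tao_finite_energy_smooth_energy_bound_holds`), and the total-speed bound
`tao2011_boundedTotalSpeed_of_hasBoundedSobolevNormsOn` is monotone in `T'`. [cite: Tao2011, Prop. 9.1 + Lemma 8.1 + Cor. 11.1] -/
theorem exists_uniform_speedBudget {ν T : ℝ} (hν : 0 < ν) (hT : 0 < T)
    {u : ℝ → EuclideanSpace ℝ (Fin 3) → EuclideanSpace ℝ (Fin 3)}
    {p : ℝ → EuclideanSpace ℝ (Fin 3) → ℝ} (hsol : IsClassicalNSSolutionOn (Ico 0 T) ν 0 u p)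
    (hLH : IsLerayHopfOn T ν 0 (u 0) u) (hdec : HasRapidSpatialDecay (u 0)) :
    ∃ B : ℝ≥0∞, B ≠ ⊤ ∧ ∀ T' < T, ∫⁻ t in Ioo 0 T', eLpNorm (u t) ∞ volume ≤ B := by
  obtain ⟨K, hK, hspeed⟩ := tao2011_boundedTotalSpeed_of_hasBoundedSobolevNormsOn
  obtain ⟨C, hC, hmain⟩ := tao_finite_energy_smooth_energy_bound_holds
  -- the energy bound from the Leray–Hopf energy inequality, and a real dissipation level `E`
  set A : ℝ≥0∞ := ENNReal.ofReal (2 * VectorCalculus.kineticEnergy (u 0)) with hA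
  have hAt : A < ⊤ := ENNReal.ofReal_lt_top
  have hEt : ∀ t ∈ Icc 0 T, ∫⁻ x, ‖u t x‖ₑ ^ 2 ≤ A := fun t ht => hLH.lintegral_enorm_sq_le hν.le ht
  have hCA : C * A ≠ ⊤ := ENNReal.mul_ne_top hC.ne hAt.ne
  set E : ℝ := (C * A).toReal + 1 with hE
  have hEpos : 0 < E := by positivity
  have hCAE : C * A ≤ ENNReal.ofReal E := by
    rw [hE, ENNReal.ofReal_add ENNReal.toReal_nonneg zero_le_one, ENNReal.ofReal_toReal hCA]
    exact le_self_add
  -- the budget at the full time `T`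
  set B : ℝ≥0∞ := ENNReal.ofReal (K * (ν ^ (-(3 / 4 : ℝ)) * Real.sqrt E * T ^ (1 / 4 : ℝ) +
    ν⁻¹ ^ 2 * E)) with hB
  refine ⟨B, ENNReal.ofReal_ne_top, fun T' hT'T => ?_⟩
  rcases le_or_gt T' 0 with hT'0 | hT'0
  · rw [Ioo_eq_empty_of_le hT'0, Measure.restrict_empty, lintegral_zero_measure]
    exact bot_le
  -- the closed sub-slab `[0, T']`
  have hsol' : IsClassicalNSSolutionOn (Icc 0 T') ν 0 u p :=
    hsol.mono (Icc_subset_Ico_right hT'T) (uniqueDiffOn_Icc hT'0)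
  have hfe : ∃ A' : ℝ≥0∞, A' < ⊤ ∧ ∀ t ∈ Icc 0 T', ∫⁻ x, ‖u t x‖ₑ ^ 2 ≤ A' :=
    ⟨A, hAt, fun t ht => hEt t ⟨ht.1, ht.2.trans hT'T.le⟩⟩
  have hH : HasBoundedSobolevNormsOn (Icc 0 T') u :=
    (tao2011_hasBoundedSobolevNormsOn.closedSlab tao2011_hasBoundedSobolevNormsOn_holds
      linfty_bound_of_hasBoundedSobolevNormsOn_holds ν T' hν hT'0 u p hsol' hfe hdec).1
  have hD : ENNReal.ofReal ν *
      ∫⁻ t in Ioo 0 T', ∫⁻ x, ENNReal.ofReal (frobeniusNormSq (fderiv ℝ (u t) x)) ≤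
        ENNReal.ofReal E := by
    refine ((hmain ν T' hν hT'0 u p hsol' hfe).2.trans ?_).trans hCAE
    exact mul_le_mul' le_rfl (hEt 0 ⟨le_rfl, hT.le⟩)
  refine (hspeed hν hT'0 hsol' hH hEpos hD).trans (ENNReal.ofReal_le_ofReal ?_)
  have h1 : T' ^ (1 / 4 : ℝ) ≤ T ^ (1 / 4 : ℝ) :=
    Real.rpow_le_rpow hT'0.le hT'T.le (by norm_num)
  have h2 : 0 ≤ ν ^ (-(3 / 4 : ℝ)) * Real.sqrt E :=
    mul_nonneg (Real.rpow_nonneg hν.le _) (Real.sqrt_nonneg _)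
  nlinarith [mul_le_mul_of_nonneg_left h1 h2]

/-! ## Unconditionally: no persistent rate `≥ c (T - t)^{-β}` with `β ≥ 1` -/

/-- **No hyper-fast persistent blow-up rate (`β ≥ 1`), unconditionally.**  A classical solution of
Navier–Stokes on `ℝ³ × [0, T)`, Leray–Hopf from a rapidly decaying datum — in particular every
maximal one, i.e. every first blow-up — does NOT satisfy `‖u(t)‖_{L^∞} ≥ c (T - t)^{-β}` for all
`t` near `T⁻`, whatever `c > 0` and `β ≥ 1`: the total speed `∫₀ᵀ ‖u‖_∞` is finite
(`exists_uniform_speedBudget`) while `∫ (T - t)^{-β}` diverges (`not_persistentRate_of_uniform_budget`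
with `q = 1`).  This is the proved `q = 1` rung of the §B candidate «SupSpeedBudget» read on the
Type-II axis (`NoHyperfastBlowup β`, `β ≥ 1`, with its strong-class hypothesis discharged).
[cite: Tao2011, Prop. 9.1 (bounded total speed); Leray1934, §20] -/
theorem not_persistentRate_of_lerayHopf {ν T : ℝ} (hν : 0 < ν) (hT : 0 < T)
    {u : ℝ → EuclideanSpace ℝ (Fin 3) → EuclideanSpace ℝ (Fin 3)}
    {p : ℝ → EuclideanSpace ℝ (Fin 3) → ℝ} (hsol : IsClassicalNSSolutionOn (Ico 0 T) ν 0 u p)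
    (hLH : IsLerayHopfOn T ν 0 (u 0) u) (hdec : HasRapidSpatialDecay (u 0))
    {β : ℝ} (hβ : 1 ≤ β) {c : ℝ} (hc : 0 < c) :
    ¬ ∀ᶠ t in 𝓝[<] T, ENNReal.ofReal (c * (T - t) ^ (-β)) ≤ eLpNorm (u t) ∞ volume := by
  obtain ⟨B, hBtop, hB⟩ := exists_uniform_speedBudget hν hT hsol hLH hdec
  refine not_persistentRate_of_uniform_budget (q := 1) hT le_rfl (by simpa using hβ) hc hBtop ?_
  intro T' hT'
  simpa only [ENNReal.rpow_one] using hB T' hT'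

/-- **Maximal-solution form** (the frame of `TypeIliouvilleNoTypeII`, stmt-NavierStokesRegularity-0056):
a maximal smooth solution, Leray–Hopf from a rapidly decaying datum, has no persistent sup-norm rate
`≥ c (T - t)^{-β}` with `β ≥ 1` at its lifespan `T`. [cite: Tao2011, Prop. 9.1] -/
theorem not_persistentRate_of_maximal {ν T : ℝ} (hν : 0 < ν) (hT : 0 < T)
    {u : ℝ → EuclideanSpace ℝ (Fin 3) → EuclideanSpace ℝ (Fin 3)}
    {p : ℝ → EuclideanSpace ℝ (Fin 3) → ℝ} (hmax : IsMaximalSmoothSolution ν 0 u p T)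
    (hLH : IsLerayHopfOn T ν 0 (u 0) u) (hdec : HasRapidSpatialDecay (u 0))
    {β : ℝ} (hβ : 1 ≤ β) {c : ℝ} (hc : 0 < c) :
    ¬ ∀ᶠ t in 𝓝[<] T, ENNReal.ofReal (c * (T - t) ^ (-β)) ≤ eLpNorm (u t) ∞ volume :=
  not_persistentRate_of_lerayHopf hν hT hmax.1 hLH hdec hβ hc

end Summit.NavierStokesRegularity.NavierStokesRegularity.Theorems.TypeIliouvilleNoTypeII.SpeedBudget

end
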